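import Summits.CriticalPhenomena.PercolationContinuityZ3.Theorems.PercNearOneGluingNoHeavyLowerTailThreeSumCells
import HarnessLib

/-!
# `NoHeavyLowerTail` (stmt-CriticalPhenomena-4575) — the 3-sum theorem for R1, measure level, part 4:
# pointwise weight identities for the four R1 cells of a glued configuration

Support file (prover prim-gen-kcluster gen 71; `--supports stmt-CriticalPhenomena-4575`).  No definitions, no
named facts, no sorries.  Blueprint KCLUSTER-gen69.md §9 (N3b), step (7).

SETTING as in part 3 (`…ThreeSumCells`): terminals `a b c` (distinct), supports `DA DB` meeting only in
`{a,b,c}`, parameters `w` vanishing off `DA ∪ DB`, `T = {a,b,c}`, blocks `ζ_A = ω ∩ DA`, `ζ_B = ω ∖ DA`.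
For a three-point cell `σ` write `F_σ(ζ) = 1_σ(ζ) · q^{k^T(ζ)}` and `M(ζ) = q^{k^T(ζ)}`.

For EVERY configuration `ω` (both sides vanish off the support) the free random-cluster weight
`w_φ(ω) = weight(ω) q^{k(ω)}` restricted to a cell of the glued instance `(a; b, c)`, times the constant
`q^{k^T(∅)}`, is `weight(ω)` times a bilinear form in the piece functions at the two blocks:
* `ThreeSum.pt_T`  — cell `abc`:   `F_c⊗M + M⊗F_c − F_c⊗F_c + F_n⊗(F_b+F_g) + (F_b+F_g)⊗F_n + F_b⊗F_g + F_g⊗F_b`;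
* `ThreeSum.pt_Ub` — cell `ab|c`:  `q · (F_b⊗F_{a|b|c} + F_{a|b|c}⊗F_b + F_b⊗F_b)`;
* `ThreeSum.pt_Uc` — cell `ac|b`:  `q · (F_g⊗F_{a|b|c} + F_{a|b|c}⊗F_g + F_g⊗F_g)`;
* `ThreeSum.pt_S`  — separating cell `S_{DA ∪ DB}`:  `q² · F_{S_{DA}} ⊗ F_{S_{DB}}`.
(Tables `ThreeSum.table_T/Ub/Uc`, join rule `ThreeSum.glued_atoms`, separation `ThreeSum.glued_S_iff`,
counts `ThreeSum.k_cell_*`, `ThreeSum.kT_add`.)  Summing these against `weight` and using the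
independence of the blocks gives the dictionary of part 5.
-/

noncomputable section

namespace Summit.CriticalPhenomena.PercolationContinuityZ3.Theorems

namespace ThreeSum

open Finset SimpleGraph Literature.Probability.Percolation Literature.Probability.Percolation.Gladkov
open Literature.Probability.Percolation.BHK2006 (weight)
open Literature.Probability.Percolation.DecisionTree (ind ind_of_mem ind_of_not_mem)
open Literature.Probability.LatticeModels RefinedRowR3 ThreePointLB
open scoped Classical

variable {V : Type*} [Fintype V]

section Pointwise

variable {DA DB : Finset (Sym2 V)} {a b c : V} (hab : a ≠ b) (hac : a ≠ c) (hbc : b ≠ c)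
  (hsepD : ∀ v : V, (∃ e ∈ DA, v ∈ e) → (∃ e ∈ DB, v ∈ e) → (v = a ∨ v = b ∨ v = c))
  (w : Sym2 V → unitInterval) (q : ℝ) (hw : ∀ e, e ∉ (↑DA ∪ ↑DB : Set (Sym2 V)) → (w e : ℝ) = 0)
include hab hac hbc hsepD hw

/-- **Pointwise decomposition, cell `abc`.**  For every `ω`, with `ζ_A = ω ∩ DA`, `ζ_B = ω ∖ DA`, `T = {a,b,c}`,
`F_σ(ζ) = 1_σ(ζ) q^{k^T(ζ)}`, `M(ζ) = q^{k^T(ζ)}`: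
`w_φ(ω) 1_{abc}(ω) q^{k^T(∅)} = weight(ω) · [F_c(ζ_A) M(ζ_B) + M(ζ_A) F_c(ζ_B) − F_c F_c + F_n(ζ_A)(F_b+F_g)(ζ_B)
 + F_n(ζ_B)(F_b+F_g)(ζ_A) + F_b(ζ_A) F_g(ζ_B) + F_g(ζ_A) F_b(ζ_B)]`. [this work] -/
theorem pt_T (ω : BondConfig V) :
    rcWeightW w q ∅ ω * ind {η : BondConfig V | b ∈ cl η.toFinset a ∧ c ∈ cl η.toFinset a} ω *
        q ^ clusterCount (∅ : BondConfig V) ({a, b, c} : Set V) =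
      weight (fun e => (w e : ℝ)) ω *
        ((ind {η : BondConfig V | b ∈ cl η.toFinset a ∧ c ∈ cl η.toFinset a} (ω ∩ ↑DA) *
              q ^ clusterCount (ω ∩ ↑DA) ({a, b, c} : Set V)) *
            q ^ clusterCount (ω \ ↑DA) ({a, b, c} : Set V) +
          q ^ clusterCount (ω ∩ ↑DA) ({a, b, c} : Set V) *
            (ind {η : BondConfig V | b ∈ cl η.toFinset a ∧ c ∈ cl η.toFinset a} (ω \ ↑DA) *
              q ^ clusterCount (ω \ ↑DA) ({a, b, c} : Set V)) -
          (ind {η : BondConfig V | b ∈ cl η.toFinset a ∧ c ∈ cl η.toFinset a} (ω ∩ ↑DA) *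
              q ^ clusterCount (ω ∩ ↑DA) ({a, b, c} : Set V)) *
            (ind {η : BondConfig V | b ∈ cl η.toFinset a ∧ c ∈ cl η.toFinset a} (ω \ ↑DA) *
              q ^ clusterCount (ω \ ↑DA) ({a, b, c} : Set V)) +
          (ind {η : BondConfig V | b ∉ cl η.toFinset a ∧ c ∉ cl η.toFinset a ∧ c ∈ cl η.toFinset b} (ω ∩ ↑DA) *
              q ^ clusterCount (ω ∩ ↑DA) ({a, b, c} : Set V)) *
            ((ind {η : BondConfig V | b ∈ cl η.toFinset a ∧ c ∉ cl η.toFinset a} (ω \ ↑DA) +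
                ind {η : BondConfig V | b ∉ cl η.toFinset a ∧ c ∈ cl η.toFinset a} (ω \ ↑DA)) *
              q ^ clusterCount (ω \ ↑DA) ({a, b, c} : Set V)) +
          (ind {η : BondConfig V | b ∉ cl η.toFinset a ∧ c ∉ cl η.toFinset a ∧ c ∈ cl η.toFinset b} (ω \ ↑DA) *
              q ^ clusterCount (ω \ ↑DA) ({a, b, c} : Set V)) *
            ((ind {η : BondConfig V | b ∈ cl η.toFinset a ∧ c ∉ cl η.toFinset a} (ω ∩ ↑DA) +
                ind {η : BondConfig V | b ∉ cl η.toFinset a ∧ c ∈ cl η.toFinset a} (ω ∩ ↑DA)) *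
              q ^ clusterCount (ω ∩ ↑DA) ({a, b, c} : Set V)) +
          (ind {η : BondConfig V | b ∈ cl η.toFinset a ∧ c ∉ cl η.toFinset a} (ω ∩ ↑DA) *
              q ^ clusterCount (ω ∩ ↑DA) ({a, b, c} : Set V)) *
            (ind {η : BondConfig V | b ∉ cl η.toFinset a ∧ c ∈ cl η.toFinset a} (ω \ ↑DA) *
              q ^ clusterCount (ω \ ↑DA) ({a, b, c} : Set V)) +
          (ind {η : BondConfig V | b ∉ cl η.toFinset a ∧ c ∈ cl η.toFinset a} (ω ∩ ↑DA) *
              q ^ clusterCount (ω ∩ ↑DA) ({a, b, c} : Set V)) *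
            (ind {η : BondConfig V | b ∈ cl η.toFinset a ∧ c ∉ cl η.toFinset a} (ω \ ↑DA) *
              q ^ clusterCount (ω \ ↑DA) ({a, b, c} : Set V))) := by
  by_cases hω : ω ⊆ ↑DA ∪ ↑DB
  · obtain ⟨jab, jac⟩ := glued_atoms hsepD hω
    obtain ⟨t1A, t2A, t3A⟩ := trans_three (a := a) (b := b) (c := c) (ω ∩ (↑DA : Set (Sym2 V)))
    obtain ⟨t1B, t2B, t3B⟩ := trans_three (a := a) (b := b) (c := c) (ω \ (↑DA : Set (Sym2 V)))
    -- the table identity for the indicators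
    have htab := table_T (x := ind {η : BondConfig V | b ∈ cl η.toFinset a ∧ c ∈ cl η.toFinset a} ω)
      (cA := ind {η : BondConfig V | b ∈ cl η.toFinset a ∧ c ∈ cl η.toFinset a} (ω ∩ ↑DA))
      (cB := ind {η : BondConfig V | b ∈ cl η.toFinset a ∧ c ∈ cl η.toFinset a} (ω \ ↑DA))
      (bA := ind {η : BondConfig V | b ∈ cl η.toFinset a ∧ c ∉ cl η.toFinset a} (ω ∩ ↑DA))
      (bB := ind {η : BondConfig V | b ∈ cl η.toFinset a ∧ c ∉ cl η.toFinset a} (ω \ ↑DA))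
      (gA := ind {η : BondConfig V | b ∉ cl η.toFinset a ∧ c ∈ cl η.toFinset a} (ω ∩ ↑DA))
      (gB := ind {η : BondConfig V | b ∉ cl η.toFinset a ∧ c ∈ cl η.toFinset a} (ω \ ↑DA))
      (nA := ind {η : BondConfig V | b ∉ cl η.toFinset a ∧ c ∉ cl η.toFinset a ∧ c ∈ cl η.toFinset b} (ω ∩ ↑DA))
      (nB := ind {η : BondConfig V | b ∉ cl η.toFinset a ∧ c ∉ cl η.toFinset a ∧ c ∈ cl η.toFinset b} (ω \ ↑DA))
      t1A t2A t3A t1B t2B t3B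
      (fun h => ind_of_mem (show ω ∈ {η : BondConfig V | b ∈ cl η.toFinset a ∧ c ∈ cl η.toFinset a} from
        ⟨jab.2 h.1, jac.2 h.2⟩))
      (fun h => ind_of_not_mem (show ω ∉ {η : BondConfig V | b ∈ cl η.toFinset a ∧ c ∈ cl η.toFinset a} from
        fun h' => h ⟨jab.1 h'.1, jac.1 h'.2⟩))
      (fun h => ind_of_mem h) (fun h => ind_of_not_mem h) (fun h => ind_of_mem h) (fun h => ind_of_not_mem h)
      (fun h => ind_of_mem h) (fun h => ind_of_not_mem h) (fun h => ind_of_mem h) (fun h => ind_of_not_mem h)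
      (fun h => ind_of_mem h) (fun h => ind_of_not_mem h) (fun h => ind_of_mem h) (fun h => ind_of_not_mem h)
      (fun h => ind_of_mem h) (fun h => ind_of_not_mem h) (fun h => ind_of_mem h) (fun h => ind_of_not_mem h)
    -- the cluster-count bookkeeping on the cell
    by_cases hT : ω ∈ {η : BondConfig V | b ∈ cl η.toFinset a ∧ c ∈ cl η.toFinset a}
    · have hk : clusterCount ω ∅ = clusterCount ω ({a, b, c} : Set V) := k_cell_T hab hac hbc ω hT.1 hT.2
      have hadd := kT_add hsepD hω
      have hpow : q ^ clusterCount ω ∅ * q ^ clusterCount (∅ : BondConfig V) ({a, b, c} : Set V) =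
          q ^ clusterCount (ω ∩ ↑DA) ({a, b, c} : Set V) * q ^ clusterCount (ω \ ↑DA) ({a, b, c} : Set V) := by
        rw [← pow_add, ← pow_add, hk, hadd]
      unfold rcWeightW
      rw [htab]
      linear_combination (weight (fun e => (w e : ℝ)) ω *
        (ind {η : BondConfig V | b ∈ cl η.toFinset a ∧ c ∈ cl η.toFinset a} (ω ∩ ↑DA) +
          ind {η : BondConfig V | b ∈ cl η.toFinset a ∧ c ∈ cl η.toFinset a} (ω \ ↑DA) -
          ind {η : BondConfig V | b ∈ cl η.toFinset a ∧ c ∈ cl η.toFinset a} (ω ∩ ↑DA) *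
            ind {η : BondConfig V | b ∈ cl η.toFinset a ∧ c ∈ cl η.toFinset a} (ω \ ↑DA) +
          ind {η : BondConfig V | b ∉ cl η.toFinset a ∧ c ∉ cl η.toFinset a ∧ c ∈ cl η.toFinset b} (ω ∩ ↑DA) *
            (ind {η : BondConfig V | b ∈ cl η.toFinset a ∧ c ∉ cl η.toFinset a} (ω \ ↑DA) +
              ind {η : BondConfig V | b ∉ cl η.toFinset a ∧ c ∈ cl η.toFinset a} (ω \ ↑DA)) +
          ind {η : BondConfig V | b ∉ cl η.toFinset a ∧ c ∉ cl η.toFinset a ∧ c ∈ cl η.toFinset b} (ω \ ↑DA) *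
            (ind {η : BondConfig V | b ∈ cl η.toFinset a ∧ c ∉ cl η.toFinset a} (ω ∩ ↑DA) +
              ind {η : BondConfig V | b ∉ cl η.toFinset a ∧ c ∈ cl η.toFinset a} (ω ∩ ↑DA)) +
          ind {η : BondConfig V | b ∈ cl η.toFinset a ∧ c ∉ cl η.toFinset a} (ω ∩ ↑DA) *
            ind {η : BondConfig V | b ∉ cl η.toFinset a ∧ c ∈ cl η.toFinset a} (ω \ ↑DA) +
          ind {η : BondConfig V | b ∉ cl η.toFinset a ∧ c ∈ cl η.toFinset a} (ω ∩ ↑DA) *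
            ind {η : BondConfig V | b ∈ cl η.toFinset a ∧ c ∉ cl η.toFinset a} (ω \ ↑DA))) * hpow
    · -- off the cell both sides vanish
      have h0 : ind {η : BondConfig V | b ∈ cl η.toFinset a ∧ c ∈ cl η.toFinset a} ω = 0 := ind_of_not_mem hT
      rw [h0] at htab
      unfold rcWeightW
      rw [h0]
      linear_combination (weight (fun e => (w e : ℝ)) ω *
        q ^ clusterCount (ω ∩ ↑DA) ({a, b, c} : Set V) * q ^ clusterCount (ω \ ↑DA) ({a, b, c} : Set V)) * htab
  · -- outside the support the weight vanishes
    have h0 : weight (fun e => (w e : ℝ)) ω = 0 := weight_eq_zero_of_not_subset w hw hω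
    unfold rcWeightW
    rw [h0]; ring


/-- **Pointwise decomposition, cell `ab|c`.**  `w_φ(ω) 1_{ab|c}(ω) q^{k^T(∅)} =
weight(ω) · q · [F_b(ζ_A) F_{a|b|c}(ζ_B) + F_{a|b|c}(ζ_A) F_b(ζ_B) + F_b(ζ_A) F_b(ζ_B)]`. [this work] -/
theorem pt_Ub (ω : BondConfig V) :
    rcWeightW w q ∅ ω * ind {η : BondConfig V | b ∈ cl η.toFinset a ∧ c ∉ cl η.toFinset a} ω *
        q ^ clusterCount (∅ : BondConfig V) ({a, b, c} : Set V) =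
      weight (fun e => (w e : ℝ)) ω * (q *
        ((ind {η : BondConfig V | b ∈ cl η.toFinset a ∧ c ∉ cl η.toFinset a} (ω ∩ ↑DA) *
              q ^ clusterCount (ω ∩ ↑DA) ({a, b, c} : Set V)) *
            (ind {η : BondConfig V | b ∉ cl η.toFinset a ∧ c ∉ cl η.toFinset a ∧ c ∉ cl η.toFinset b} (ω \ ↑DA) *
              q ^ clusterCount (ω \ ↑DA) ({a, b, c} : Set V)) +
          (ind {η : BondConfig V | b ∉ cl η.toFinset a ∧ c ∉ cl η.toFinset a ∧ c ∉ cl η.toFinset b} (ω ∩ ↑DA) *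
              q ^ clusterCount (ω ∩ ↑DA) ({a, b, c} : Set V)) *
            (ind {η : BondConfig V | b ∈ cl η.toFinset a ∧ c ∉ cl η.toFinset a} (ω \ ↑DA) *
              q ^ clusterCount (ω \ ↑DA) ({a, b, c} : Set V)) +
          (ind {η : BondConfig V | b ∈ cl η.toFinset a ∧ c ∉ cl η.toFinset a} (ω ∩ ↑DA) *
              q ^ clusterCount (ω ∩ ↑DA) ({a, b, c} : Set V)) *
            (ind {η : BondConfig V | b ∈ cl η.toFinset a ∧ c ∉ cl η.toFinset a} (ω \ ↑DA) *
              q ^ clusterCount (ω \ ↑DA) ({a, b, c} : Set V)))) := by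
  by_cases hω : ω ⊆ ↑DA ∪ ↑DB
  · obtain ⟨jab, jac⟩ := glued_atoms hsepD hω
    obtain ⟨t1A, t2A, t3A⟩ := trans_three (a := a) (b := b) (c := c) (ω ∩ (↑DA : Set (Sym2 V)))
    obtain ⟨t1B, t2B, t3B⟩ := trans_three (a := a) (b := b) (c := c) (ω \ (↑DA : Set (Sym2 V)))
    have htab := table_Ub (x := ind {η : BondConfig V | b ∈ cl η.toFinset a ∧ c ∉ cl η.toFinset a} ω)
      (bA := ind {η : BondConfig V | b ∈ cl η.toFinset a ∧ c ∉ cl η.toFinset a} (ω ∩ ↑DA))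
      (bB := ind {η : BondConfig V | b ∈ cl η.toFinset a ∧ c ∉ cl η.toFinset a} (ω \ ↑DA))
      (zA := ind {η : BondConfig V | b ∉ cl η.toFinset a ∧ c ∉ cl η.toFinset a ∧ c ∉ cl η.toFinset b} (ω ∩ ↑DA))
      (zB := ind {η : BondConfig V | b ∉ cl η.toFinset a ∧ c ∉ cl η.toFinset a ∧ c ∉ cl η.toFinset b} (ω \ ↑DA))
      t1A t2A t3A t1B t2B t3B
      (fun h => ind_of_mem (show ω ∈ {η : BondConfig V | b ∈ cl η.toFinset a ∧ c ∉ cl η.toFinset a} from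
        ⟨jab.2 h.1, fun h' => h.2 (jac.1 h')⟩))
      (fun h => ind_of_not_mem (show ω ∉ {η : BondConfig V | b ∈ cl η.toFinset a ∧ c ∉ cl η.toFinset a} from
        fun h' => h ⟨jab.1 h'.1, fun h'' => h'.2 (jac.2 h'')⟩))
      (fun h => ind_of_mem h) (fun h => ind_of_not_mem h) (fun h => ind_of_mem h) (fun h => ind_of_not_mem h)
      (fun h => ind_of_mem h) (fun h => ind_of_not_mem h) (fun h => ind_of_mem h) (fun h => ind_of_not_mem h)
    by_cases hU : ω ∈ {η : BondConfig V | b ∈ cl η.toFinset a ∧ c ∉ cl η.toFinset a}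
    · have hk : clusterCount ω ∅ = clusterCount ω ({a, b, c} : Set V) + 1 := k_cell_Ub hab hac hbc ω hU.1 hU.2
      have hadd := kT_add hsepD hω
      have hpow : q ^ clusterCount ω ∅ * q ^ clusterCount (∅ : BondConfig V) ({a, b, c} : Set V) =
          q * (q ^ clusterCount (ω ∩ ↑DA) ({a, b, c} : Set V) * q ^ clusterCount (ω \ ↑DA) ({a, b, c} : Set V)) := by
        rw [← pow_add, ← pow_add, hk, ← pow_succ', Nat.add_right_comm, hadd]
      unfold rcWeightW
      rw [htab]
      linear_combination (weight (fun e => (w e : ℝ)) ω *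
        (ind {η : BondConfig V | b ∈ cl η.toFinset a ∧ c ∉ cl η.toFinset a} (ω ∩ ↑DA) *
            ind {η : BondConfig V | b ∉ cl η.toFinset a ∧ c ∉ cl η.toFinset a ∧ c ∉ cl η.toFinset b} (ω \ ↑DA) +
          ind {η : BondConfig V | b ∉ cl η.toFinset a ∧ c ∉ cl η.toFinset a ∧ c ∉ cl η.toFinset b} (ω ∩ ↑DA) *
            ind {η : BondConfig V | b ∈ cl η.toFinset a ∧ c ∉ cl η.toFinset a} (ω \ ↑DA) +
          ind {η : BondConfig V | b ∈ cl η.toFinset a ∧ c ∉ cl η.toFinset a} (ω ∩ ↑DA) *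
            ind {η : BondConfig V | b ∈ cl η.toFinset a ∧ c ∉ cl η.toFinset a} (ω \ ↑DA))) * hpow
    · have h0 : ind {η : BondConfig V | b ∈ cl η.toFinset a ∧ c ∉ cl η.toFinset a} ω = 0 := ind_of_not_mem hU
      rw [h0] at htab
      unfold rcWeightW
      rw [h0]
      linear_combination (weight (fun e => (w e : ℝ)) ω * q *
        q ^ clusterCount (ω ∩ ↑DA) ({a, b, c} : Set V) * q ^ clusterCount (ω \ ↑DA) ({a, b, c} : Set V)) * htab
  · have h0 : weight (fun e => (w e : ℝ)) ω = 0 := weight_eq_zero_of_not_subset w hw hω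
    unfold rcWeightW
    rw [h0]; ring

/-- **Pointwise decomposition, cell `ac|b`.**  `w_φ(ω) 1_{ac|b}(ω) q^{k^T(∅)} =
weight(ω) · q · [F_g(ζ_A) F_{a|b|c}(ζ_B) + F_{a|b|c}(ζ_A) F_g(ζ_B) + F_g(ζ_A) F_g(ζ_B)]`. [this work] -/
theorem pt_Uc (ω : BondConfig V) :
    rcWeightW w q ∅ ω * ind {η : BondConfig V | b ∉ cl η.toFinset a ∧ c ∈ cl η.toFinset a} ω *
        q ^ clusterCount (∅ : BondConfig V) ({a, b, c} : Set V) =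
      weight (fun e => (w e : ℝ)) ω * (q *
        ((ind {η : BondConfig V | b ∉ cl η.toFinset a ∧ c ∈ cl η.toFinset a} (ω ∩ ↑DA) *
              q ^ clusterCount (ω ∩ ↑DA) ({a, b, c} : Set V)) *
            (ind {η : BondConfig V | b ∉ cl η.toFinset a ∧ c ∉ cl η.toFinset a ∧ c ∉ cl η.toFinset b} (ω \ ↑DA) *
              q ^ clusterCount (ω \ ↑DA) ({a, b, c} : Set V)) +
          (ind {η : BondConfig V | b ∉ cl η.toFinset a ∧ c ∉ cl η.toFinset a ∧ c ∉ cl η.toFinset b} (ω ∩ ↑DA) *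
              q ^ clusterCount (ω ∩ ↑DA) ({a, b, c} : Set V)) *
            (ind {η : BondConfig V | b ∉ cl η.toFinset a ∧ c ∈ cl η.toFinset a} (ω \ ↑DA) *
              q ^ clusterCount (ω \ ↑DA) ({a, b, c} : Set V)) +
          (ind {η : BondConfig V | b ∉ cl η.toFinset a ∧ c ∈ cl η.toFinset a} (ω ∩ ↑DA) *
              q ^ clusterCount (ω ∩ ↑DA) ({a, b, c} : Set V)) *
            (ind {η : BondConfig V | b ∉ cl η.toFinset a ∧ c ∈ cl η.toFinset a} (ω \ ↑DA) *
              q ^ clusterCount (ω \ ↑DA) ({a, b, c} : Set V)))) := by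
  by_cases hω : ω ⊆ ↑DA ∪ ↑DB
  · obtain ⟨jab, jac⟩ := glued_atoms hsepD hω
    obtain ⟨t1A, t2A, t3A⟩ := trans_three (a := a) (b := b) (c := c) (ω ∩ (↑DA : Set (Sym2 V)))
    obtain ⟨t1B, t2B, t3B⟩ := trans_three (a := a) (b := b) (c := c) (ω \ (↑DA : Set (Sym2 V)))
    have htab := table_Uc (x := ind {η : BondConfig V | b ∉ cl η.toFinset a ∧ c ∈ cl η.toFinset a} ω)
      (gA := ind {η : BondConfig V | b ∉ cl η.toFinset a ∧ c ∈ cl η.toFinset a} (ω ∩ ↑DA))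
      (gB := ind {η : BondConfig V | b ∉ cl η.toFinset a ∧ c ∈ cl η.toFinset a} (ω \ ↑DA))
      (zA := ind {η : BondConfig V | b ∉ cl η.toFinset a ∧ c ∉ cl η.toFinset a ∧ c ∉ cl η.toFinset b} (ω ∩ ↑DA))
      (zB := ind {η : BondConfig V | b ∉ cl η.toFinset a ∧ c ∉ cl η.toFinset a ∧ c ∉ cl η.toFinset b} (ω \ ↑DA))
      t1A t2A t3A t1B t2B t3B
      (fun h => ind_of_mem (show ω ∈ {η : BondConfig V | b ∉ cl η.toFinset a ∧ c ∈ cl η.toFinset a} from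
        ⟨fun h' => h.1 (jab.1 h'), jac.2 h.2⟩))
      (fun h => ind_of_not_mem (show ω ∉ {η : BondConfig V | b ∉ cl η.toFinset a ∧ c ∈ cl η.toFinset a} from
        fun h' => h ⟨fun h'' => h'.1 (jab.2 h''), jac.1 h'.2⟩))
      (fun h => ind_of_mem h) (fun h => ind_of_not_mem h) (fun h => ind_of_mem h) (fun h => ind_of_not_mem h)
      (fun h => ind_of_mem h) (fun h => ind_of_not_mem h) (fun h => ind_of_mem h) (fun h => ind_of_not_mem h)
    by_cases hU : ω ∈ {η : BondConfig V | b ∉ cl η.toFinset a ∧ c ∈ cl η.toFinset a}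
    · have hk : clusterCount ω ∅ = clusterCount ω ({a, b, c} : Set V) + 1 := k_cell_Uc hab hac hbc ω hU.1 hU.2
      have hadd := kT_add hsepD hω
      have hpow : q ^ clusterCount ω ∅ * q ^ clusterCount (∅ : BondConfig V) ({a, b, c} : Set V) =
          q * (q ^ clusterCount (ω ∩ ↑DA) ({a, b, c} : Set V) * q ^ clusterCount (ω \ ↑DA) ({a, b, c} : Set V)) := by
        rw [← pow_add, ← pow_add, hk, ← pow_succ', Nat.add_right_comm, hadd]
      unfold rcWeightW
      rw [htab]
      linear_combination (weight (fun e => (w e : ℝ)) ω *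
        (ind {η : BondConfig V | b ∉ cl η.toFinset a ∧ c ∈ cl η.toFinset a} (ω ∩ ↑DA) *
            ind {η : BondConfig V | b ∉ cl η.toFinset a ∧ c ∉ cl η.toFinset a ∧ c ∉ cl η.toFinset b} (ω \ ↑DA) +
          ind {η : BondConfig V | b ∉ cl η.toFinset a ∧ c ∉ cl η.toFinset a ∧ c ∉ cl η.toFinset b} (ω ∩ ↑DA) *
            ind {η : BondConfig V | b ∉ cl η.toFinset a ∧ c ∈ cl η.toFinset a} (ω \ ↑DA) +
          ind {η : BondConfig V | b ∉ cl η.toFinset a ∧ c ∈ cl η.toFinset a} (ω ∩ ↑DA) *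
            ind {η : BondConfig V | b ∉ cl η.toFinset a ∧ c ∈ cl η.toFinset a} (ω \ ↑DA))) * hpow
    · have h0 : ind {η : BondConfig V | b ∉ cl η.toFinset a ∧ c ∈ cl η.toFinset a} ω = 0 := ind_of_not_mem hU
      rw [h0] at htab
      unfold rcWeightW
      rw [h0]
      linear_combination (weight (fun e => (w e : ℝ)) ω * q *
        q ^ clusterCount (ω ∩ ↑DA) ({a, b, c} : Set V) * q ^ clusterCount (ω \ ↑DA) ({a, b, c} : Set V)) * htab
  · have h0 : weight (fun e => (w e : ℝ)) ω = 0 := weight_eq_zero_of_not_subset w hw hω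
    unfold rcWeightW
    rw [h0]; ring

/-- **Pointwise decomposition, separating cell.**  With `S_D = {b, c ∉ C(a), C(a) meets every b–c path of D}`:
`w_φ(ω) 1_{S_{DA∪DB}}(ω) q^{k^T(∅)} = weight(ω) · q² · F_{S_{DA}}(ζ_A) F_{S_{DB}}(ζ_B)`. [this work] -/
theorem pt_S (ω : BondConfig V) :
    rcWeightW w q ∅ ω *
          ind {η : BondConfig V | b ∉ cl η.toFinset a ∧ c ∉ cl η.toFinset a ∧ Sep (DA ∪ DB) (cl η.toFinset a) b c} ω *
        q ^ clusterCount (∅ : BondConfig V) ({a, b, c} : Set V) =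
      weight (fun e => (w e : ℝ)) ω * (q ^ 2 *
        ((ind {η : BondConfig V | b ∉ cl η.toFinset a ∧ c ∉ cl η.toFinset a ∧ Sep DA (cl η.toFinset a) b c} (ω ∩ ↑DA) *
            q ^ clusterCount (ω ∩ ↑DA) ({a, b, c} : Set V)) *
          (ind {η : BondConfig V | b ∉ cl η.toFinset a ∧ c ∉ cl η.toFinset a ∧ Sep DB (cl η.toFinset a) b c} (ω \ ↑DA) *
            q ^ clusterCount (ω \ ↑DA) ({a, b, c} : Set V)))) := by
  by_cases hω : ω ⊆ ↑DA ∪ ↑DB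
  · have hS := glued_S_iff (a := a) (b := b) (c := c) hab hsepD hω
    by_cases hSω : ω ∈ {η : BondConfig V | b ∉ cl η.toFinset a ∧ c ∉ cl η.toFinset a ∧
        Sep (DA ∪ DB) (cl η.toFinset a) b c}
    · obtain ⟨hSA, hSB⟩ := hS.1 hSω
      have hcb : c ∉ cl ω.toFinset b := fun h =>
        not_sep_of_mem_cl (toFinset_subset_of_subset hω) hSω.1 h hSω.2.2
      have hk : clusterCount ω ∅ = clusterCount ω ({a, b, c} : Set V) + 2 :=
        k_cell_apart hab hac hbc ω hSω.1 hSω.2.1 hcb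
      have hadd := kT_add hsepD hω
      have hpow : q ^ clusterCount ω ∅ * q ^ clusterCount (∅ : BondConfig V) ({a, b, c} : Set V) =
          q ^ 2 * (q ^ clusterCount (ω ∩ ↑DA) ({a, b, c} : Set V) * q ^ clusterCount (ω \ ↑DA) ({a, b, c} : Set V)) := by
        rw [← pow_add, ← pow_add, ← pow_add, hk, Nat.add_right_comm, hadd, Nat.add_comm]
      unfold rcWeightW
      rw [ind_of_mem hSω, ind_of_mem hSA, ind_of_mem hSB]
      linear_combination (weight (fun e => (w e : ℝ)) ω) * hpow
    · unfold rcWeightW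
      rw [ind_of_not_mem hSω]
      have h0 : ind {η : BondConfig V | b ∉ cl η.toFinset a ∧ c ∉ cl η.toFinset a ∧ Sep DA (cl η.toFinset a) b c}
            (ω ∩ ↑DA) *
          ind {η : BondConfig V | b ∉ cl η.toFinset a ∧ c ∉ cl η.toFinset a ∧ Sep DB (cl η.toFinset a) b c}
            (ω \ ↑DA) = 0 := by
        by_cases hA : (ω ∩ ↑DA) ∈ {η : BondConfig V | b ∉ cl η.toFinset a ∧ c ∉ cl η.toFinset a ∧
            Sep DA (cl η.toFinset a) b c}
        · have hB : (ω \ ↑DA) ∉ {η : BondConfig V | b ∉ cl η.toFinset a ∧ c ∉ cl η.toFinset a ∧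
              Sep DB (cl η.toFinset a) b c} := fun hB => hSω (hS.2 ⟨hA, hB⟩)
          rw [ind_of_not_mem hB, mul_zero]
        · rw [ind_of_not_mem hA, zero_mul]
      linear_combination (-(weight (fun e => (w e : ℝ)) ω * q ^ 2 *
        q ^ clusterCount (ω ∩ ↑DA) ({a, b, c} : Set V) * q ^ clusterCount (ω \ ↑DA) ({a, b, c} : Set V))) * h0
  · have h0 : weight (fun e => (w e : ℝ)) ω = 0 := weight_eq_zero_of_not_subset w hw hω
    unfold rcWeightW
    rw [h0]; ring

end Pointwise

end ThreeSum

end Summit.CriticalPhenomena.PercolationContinuityZ3.Theorems
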